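import Summits.CriticalPhenomena.CardyFormulaZ2.Theorems.CardyBoundaryCoulombGasHalfPlaneMarkDensityLawNecessity
import Summits.CriticalPhenomena.CardyFormulaZ2.Theorems.CardyBoundaryCoulombGasHalfPlaneMarkDensityLawRigidityLemmas
import Summits.CriticalPhenomena.CardyFormulaZ2.Theorems.CardyBoundaryCoulombGasHalfPlaneMarkDensityLawEquivalence

/-!
# Line `Sketch` — RIGIDITY: the collinear half-plane Cardy law pins every conformal crossing limit
# (crux `HalfPlaneMarkDensityLaw`, stmt-CriticalPhenomena-5661, route CardyBoundaryCoulombGas)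

Let C⁺ be the one open stub of the line (collinear half-plane Cardy for bond-`ℤ²`,
`⟺ HalfPlaneMarkDensityLaw` by `stub_equivalence`).  THEOREM (`eqOn_cardyFunction_of_collinearCardy`):
if C⁺ holds and some function `f : ℝ → ℝ` is a crossing limit of bond-`ℤ²` for EVERY conformal
rectangle (`∀ R, R.HasCrossingLimit (bondDomainCrossingProb R) f`, i.e. the "unique conformal limit"
hypothesis `UniqueConformalLimit` of route CardyPerronTeleport with its witness), then `f = F` on
`(0,1)`.

Proof (box exhaustion run backwards; parts 3–6 of `…BoxExhaustion*`).  Fix `x₀ ∈ (0,1)` and the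
symmetric prevertex tuple `p = (−1/4, −g, g, 1/4)`, `g = (1−√x₀)/(4(1+√x₀))`, whose cross-ratio is
`x₀`; by scale invariance `crossRatio (t·p) = x₀` for every `t > 0`, so the Schwarz–Christoffel box
`R_t` with prevertices `t·p` (part 4, `exists_scBox`) has `bondDomainCrossingProb R_t (δ) → f x₀`.
Its bottom marks are `G(t pᵢ) = t·mᵢ(t)` with `mᵢ(t) = G(t pᵢ)/t → pᵢ` (`G'(0) = 1`).  At mesh `t/n`
the lattice sandwich of part 3 reads
`bondDomainCrossingProb R_t (t/n) ≤ P_n(m(t))` and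
`P_n(m₀(t)+ε', m₁(t), m₂(t)+ε', m₃(t)) ≤ bondDomainCrossingProb R_t (t/n) + P[Λ_{3n} ↔ Λ_{3nL}ᶜ]`,
and C⁺ evaluates the two half-plane limits: `f x₀ ≤ F(η(m(t)))` and
`F(η(m(t) + ε'e)) ≤ f x₀ + C L^{-α}`.  With `t = κ/L → 0`: `η(m(t)) → x₀`, `η(m(t)+ε'e) → η(p+ε'e)`,
then `ε' → 0`; continuity of `F` on `(0,1)` gives `f x₀ = F x₀`.

Consequences (file `…RigidityCorollaries`, all BY NAME): `CardyFormulaZ2 ↔ HalfPlaneMarkDensityLaw ∧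
UniqueConformalLimit` (crux 5 is exactly the VALUE half of Cardy's formula on `ℤ²`; existence and
conformal invariance of the limit, stmt-CriticalPhenomena-0745, is the other half), and crux 5 implies the
shared identification crux `CardyRigidity` (stmt-CriticalPhenomena-0746, nine routes).  Here already:
`halfStripRigidity_of_collinearCardy` — C⁺ discharges the conclusion of the support item
`HalfStripRigidity` (stmt-CriticalPhenomena-5181) of route CardyPerronTeleport; with the half-strip
exhaustion `collinearCardy_of_halfStripCardyZ2` (file `…FromHalfStrip`) that item follows outright
(file `…HalfStripRigidity`).
-/

noncomputable section

namespace Summit.CriticalPhenomena.CardyFormulaZ2.Cruxes.HalfPlaneMarkDensityLaw.SketchLine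

open Set Metric MeasureTheory Filter
open Literature.Probability.LatticeModels
open Literature.Probability.Percolation hiding cardyFunction
open Literature.Probability.RandomPlanarGeometry
open UpperHalfPlane (upperHalfPlaneSet)
open Summit.CriticalPhenomena.CardyFormulaZ2.Theorems.HalfPlaneMarkDensityLaw.Negative
open Summit.CriticalPhenomena.CardyFormulaZ2.Theses.CardyBoundaryCoulombGas (HalfPlaneMarkDensityLaw)
open scoped Topology

namespace Rigidity

/-! ## The rigidity theorem -/

/-- **Rigidity.** The collinear half-plane Cardy law C⁺ for bond-`ℤ²` identifies every conformal
crossing limit: if `f` is a crossing limit of `bondDomainCrossingProb R` for every conformal rectangle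
`R`, then `f = F` on `(0,1)`. [folklore] -/
theorem eqOn_cardyFunction_of_collinearCardy
    (hC : ∀ a b c y : ℝ, a < b → b < c → c < y →
      Tendsto (fun n : ℕ ↦ μ.real (openCrossing halfPlane (arcA a b n) (rowIcc ⌊c * n⌋ ⌊y * n⌋))) atTop
        (𝓝 (cardyFunction (crossRatio ![a, b, c, y]))))
    (f : ℝ → ℝ) (hf : ∀ R : ConformalRectangle, R.HasCrossingLimit (bondDomainCrossingProb R) f) :
    EqOn f cardyFunction (Ioo 0 1) := by
  intro x₀ hx₀
  /- Step 0: the Schwarz–Christoffel box and the boundary map `G`. -/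
  obtain ⟨K, H, hK, hH, -, hbox⟩ := BoxExhaustion.exists_scBox
  set G : ℝ → ℝ := ellipticF ((1 / 2 : ℝ) ^ 2) with hG
  have hm0 : (0 : ℝ) ≤ (1 / 2 : ℝ) ^ 2 := by positivity
  have hm1 : (1 / 2 : ℝ) ^ 2 < 1 := by norm_num
  have hGm : StrictMonoOn G (Icc (-1) 1) := strictMonoOn_ellipticF hm0 hm1
  have hG0 : G 0 = 0 := ellipticF_zero _
  have hGd : HasDerivAt G 1 0 := BoxExhaustion.hasDerivAt_ellipticF_zero
  /- Step 1: constants and the prevertex tuple. -/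
  obtain ⟨C₀, α, -, hα, hesc⟩ := exists_real_boxToFar_le_rpow_of_le_half
  obtain ⟨p, hp, hp4, hpx⟩ := exists_tuple hx₀
  have hp01 := hp (show (0 : Fin 4) < 1 by decide)
  have hp12 := hp (show (1 : Fin 4) < 2 by decide)
  have hp23 := hp (show (2 : Fin 4) < 3 by decide)
  set d : ℝ := min (p 1 - p 0) (p 3 - p 2) with hd
  have hd0 : 0 < d := lt_min (by linarith) (by linarith)
  set κ : ℝ := min (min K H / 9) 1 with hκ
  have hκ0 : 0 < κ := lt_min (by positivity) one_pos
  have hκ1 : κ ≤ 1 := min_le_right _ _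
  have hκKH : 9 * κ ≤ min K H := by
    have := min_le_left (min K H / 9) 1; rw [← hκ] at this; linarith
  have hκK : 9 * κ ≤ K := hκKH.trans (min_le_left _ _)
  have hκH : 9 * κ ≤ H := hκKH.trans (min_le_right _ _)
  -- the lattice marks at scale `t`
  set m : ℝ → Fin 4 → ℝ := fun t i ↦ G (t * p i) / t with hm
  have hm_mul : ∀ t, 0 < t → ∀ i, t * m t i = G (t * p i) := fun t ht i ↦ by
    simp only [hm]; rw [mul_div_cancel₀ _ ht.ne']
  -- `|t pᵢ| ≤ 1` and `|G (t pᵢ)| ≤ …`: marks bounded by `1` for `t ≤ 1`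
  have htp : ∀ t, 0 < t → t ≤ 1 → ∀ i, t * p i ∈ Icc (-1 : ℝ) 1 := fun t ht ht1 i ↦ by
    have h1 : |t * p i| ≤ t * (1 / 4) := by
      rw [abs_mul, abs_of_pos ht]; exact mul_le_mul_of_nonneg_left (hp4 i) ht.le
    rw [abs_le] at h1
    constructor <;> linarith [h1.1, h1.2]
  have hm_mono : ∀ t, 0 < t → t ≤ 1 → StrictMono (m t) := fun t ht ht1 i j hij ↦ by
    simp only [hm]
    refine div_lt_div_of_pos_right ?_ ht
    exact hGm (htp t ht ht1 i) (htp t ht ht1 j) (mul_lt_mul_of_pos_left (hp hij) ht)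
  /- Step 2: continuity facts. -/
  have hFcont : ∀ {x : ℝ}, x ∈ Ioo (0 : ℝ) 1 → ContinuousAt cardyFunction x := fun hx ↦
    continuousOn_cardyFunction_Ioo.continuousAt (Ioo_mem_nhds hx.1 hx.2)
  -- the shifted tuples `p + ε' e`
  have hpε_mono : ∀ ε', 0 ≤ ε' → ε' < d → StrictMono (![p 0 + ε', p 1, p 2 + ε', p 3] : Fin 4 → ℝ) := by
    intro ε' h0 h1
    have h1' : ε' < p 1 - p 0 := lt_of_lt_of_le h1 (min_le_left _ _)
    have h2' : ε' < p 3 - p 2 := lt_of_lt_of_le h1 (min_le_right _ _)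
    exact BoxExhaustion.strictMono_marks (by linarith) (by linarith) (by linarith)
  -- `ε' ↦ F(η(p + ε' e))` is continuous at `0⁺` with value `F x₀`
  have hlimε : Tendsto (fun ε' : ℝ ↦ cardyFunction (crossRatio ![p 0 + ε', p 1, p 2 + ε', p 3]))
      (𝓝[>] 0) (𝓝 (cardyFunction x₀)) := by
    have h1 : Tendsto (fun ε' : ℝ ↦ (![p 0 + ε', p 1, p 2 + ε', p 3] : Fin 4 → ℝ)) (𝓝 0)
        (𝓝 ![p 0 + 0, p 1, p 2 + 0, p 3]) :=
      (tendsto_const_nhds.add tendsto_id).matrixVecCons (tendsto_const_nhds.matrixVecCons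
        ((tendsto_const_nhds.add tendsto_id).matrixVecCons
          (tendsto_const_nhds.matrixVecCons tendsto_const_nhds)))
    have h2 : (![p 0 + 0, p 1, p 2 + 0, p 3] : Fin 4 → ℝ) = p := by
      rw [add_zero, add_zero]; exact vec4_eta p
    rw [h2] at h1
    have h3 := (hFcont (hpx ▸ crossRatio_mem_Ioo (Or.inl hp))).tendsto.comp
      ((BoxExhaustion.continuousAt_crossRatio (BoxExhaustion.crossRatio_den_ne_zero hp)).tendsto.comp h1)
    rw [hpx] at h3
    exact h3.mono_left nhdsWithin_le_nhds
  /- Step 3: `|f x₀ - F x₀| < ε` for every `ε > 0`. -/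
  refine eq_of_forall_dist_le fun ε hε ↦ ?_
  rw [Real.dist_eq]
  -- (3a) the slack `ε'`
  obtain ⟨ε', hε'0, hε'd, hε'1, hε'F⟩ : ∃ ε' : ℝ, 0 < ε' ∧ ε' < d ∧ ε' ≤ 1 ∧
      cardyFunction x₀ - ε / 3 < cardyFunction (crossRatio ![p 0 + ε', p 1, p 2 + ε', p 3]) := by
    have hev1 : ∀ᶠ ε' in 𝓝[>] (0 : ℝ),
        cardyFunction x₀ - ε / 3 < cardyFunction (crossRatio ![p 0 + ε', p 1, p 2 + ε', p 3]) :=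
      hlimε (Ioi_mem_nhds (by linarith))
    have hev2 : ∀ᶠ ε' in 𝓝[>] (0 : ℝ), ε' < min d 1 :=
      (eventually_lt_nhds (lt_min hd0 one_pos)).filter_mono nhdsWithin_le_nhds
    obtain ⟨ε', ⟨h1, h2⟩, h3⟩ := ((hev1.and hev2).and self_mem_nhdsWithin).exists
    exact ⟨ε', h3, lt_of_lt_of_le h2 (min_le_left _ _), (h2.le.trans (min_le_right _ _)), h1⟩
  have hpε := hpε_mono ε' hε'0.le hε'd
  have hηε : crossRatio ![p 0 + ε', p 1, p 2 + ε', p 3] ∈ Ioo (0 : ℝ) 1 := crossRatio_mem_Ioo (Or.inl hpε)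
  -- (3b) the two half-plane moduli as `t → 0⁺`
  have hlim_lo : Tendsto (fun t : ℝ ↦ cardyFunction (crossRatio ![m t 0, m t 1, m t 2, m t 3])) (𝓝[>] 0)
      (𝓝 (cardyFunction x₀)) := by
    have h1 := tendsto_marks hG0 hGd p 0 0
    simp only [add_zero] at h1
    rw [vec4_eta p] at h1
    have h3 := (hFcont (hpx ▸ crossRatio_mem_Ioo (Or.inl hp))).tendsto.comp
      ((BoxExhaustion.continuousAt_crossRatio (BoxExhaustion.crossRatio_den_ne_zero hp)).tendsto.comp h1)
    rw [hpx] at h3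
    exact h3
  have hlim_hi : Tendsto (fun t : ℝ ↦ cardyFunction (crossRatio ![m t 0 + ε', m t 1, m t 2 + ε', m t 3]))
      (𝓝[>] 0) (𝓝 (cardyFunction (crossRatio ![p 0 + ε', p 1, p 2 + ε', p 3]))) := by
    have h1 := tendsto_marks hG0 hGd p ε' ε'
    exact (hFcont hηε).tendsto.comp
      ((BoxExhaustion.continuousAt_crossRatio (BoxExhaustion.crossRatio_den_ne_zero hpε)).tendsto.comp h1)
  -- the gaps of `m t` eventually exceed `ε'` (so that the shifted marks stay increasing)
  have hgap : ∀ᶠ t in 𝓝[>] (0 : ℝ), ε' < m t 1 - m t 0 ∧ ε' < m t 3 - m t 2 := by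
    have h1 := tendsto_marks hG0 hGd p 0 0
    simp only [add_zero] at h1
    rw [tendsto_pi_nhds] at h1
    have e0 := h1 0; have e1 := h1 1; have e2 := h1 2; have e3 := h1 3
    simp only [Matrix.cons_val_zero, Matrix.cons_val_one, Matrix.cons_val] at e0 e1 e2 e3
    have hε'1 : ε' < p 1 - p 0 := lt_of_lt_of_le hε'd (min_le_left _ _)
    have hε'2 : ε' < p 3 - p 2 := lt_of_lt_of_le hε'd (min_le_right _ _)
    have g1 : ∀ᶠ t in 𝓝[>] (0 : ℝ), ε' < m t 1 - m t 0 :=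
      (e1.sub e0) (Ioi_mem_nhds hε'1)
    have g2 : ∀ᶠ t in 𝓝[>] (0 : ℝ), ε' < m t 3 - m t 2 :=
      (e3.sub e2) (Ioi_mem_nhds hε'2)
    exact g1.and g2
  -- the marks are eventually bounded by `2`
  have hbound : ∀ᶠ t in 𝓝[>] (0 : ℝ), ∀ i, |m t i| < 2 := by
    have h1 := tendsto_marks hG0 hGd p 0 0
    simp only [add_zero] at h1
    rw [vec4_eta] at h1
    have h2 : ∀ᶠ t in 𝓝[>] (0 : ℝ), dist (![m t 0, m t 1, m t 2, m t 3] : Fin 4 → ℝ) p < 1 :=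
      (Metric.tendsto_nhds.1 h1) 1 one_pos
    filter_upwards [h2] with t ht i
    have hi : dist ((![m t 0, m t 1, m t 2, m t 3] : Fin 4 → ℝ) i) (p i) < 1 :=
      lt_of_le_of_lt (dist_le_pi_dist _ _ i) ht
    rw [vec4_eta (m t)] at hi
    rw [Real.dist_eq] at hi
    have := hp4 i
    have h3 := abs_sub_abs_le_abs_sub (m t i) (p i)
    linarith
  -- (3c) choose the annulus parameter `L` (and with it the scale `t = κ/L`)
  have hevL : ∀ᶠ L : ℕ in atTop,
      (cardyFunction (crossRatio ![m (κ / L) 0, m (κ / L) 1, m (κ / L) 2, m (κ / L) 3]) <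
          cardyFunction x₀ + ε / 3 ∧
        cardyFunction (crossRatio ![p 0 + ε', p 1, p 2 + ε', p 3]) - ε / 3 <
          cardyFunction (crossRatio ![m (κ / L) 0 + ε', m (κ / L) 1, m (κ / L) 2 + ε', m (κ / L) 3]) ∧
        ((ε' < m (κ / L) 1 - m (κ / L) 0 ∧ ε' < m (κ / L) 3 - m (κ / L) 2) ∧ ∀ i, |m (κ / L) i| < 2)) ∧
      (C₀ * ((L : ℝ)⁻¹) ^ α < ε / 3 ∧ 1 ≤ L) := by
    refine (Filter.Eventually.and ?_ (Filter.Eventually.and ?_ ?_)).and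
      (((BoxExhaustion.tendsto_const_mul_inv_rpow C₀ hα).eventually
        (eventually_lt_nhds (show (0 : ℝ) < ε / 3 by positivity))).and (eventually_ge_atTop 1))
    · exact (hlim_lo.comp (BoxExhaustion.tendsto_div_nat_nhdsWithin hκ0)).eventually
        (eventually_lt_nhds (by linarith))
    · exact (hlim_hi.comp (BoxExhaustion.tendsto_div_nat_nhdsWithin hκ0)).eventually
        (eventually_gt_nhds (by linarith))
    · exact (BoxExhaustion.tendsto_div_nat_nhdsWithin hκ0).eventually (hgap.and hbound)
  obtain ⟨L, ⟨hL1, hL2, ⟨hgap1, hgap2⟩, hbd⟩, hL3, hL⟩ := hevL.exists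
  set t : ℝ := κ / L with ht
  have hLpos : (0 : ℝ) < L := by exact_mod_cast hL
  have hL1r : (1 : ℝ) ≤ L := by exact_mod_cast hL
  have ht0 : 0 < t := div_pos hκ0 hLpos
  have htκ : t ≤ κ := div_le_self hκ0.le hL1r
  have ht1 : t ≤ 1 := htκ.trans hκ1
  have htL : t * L = κ := div_mul_cancel₀ κ hLpos.ne'
  /- Step 4: the box at scale `t` and its limit `f x₀`. -/
  have hu_mono : StrictMono (fun i ↦ t * p i) := fun i j hij ↦ mul_lt_mul_of_pos_left (hp hij) ht0
  have hu_mem : ∀ i, t * p i ∈ Ioo (-1 : ℝ) 1 := fun i ↦ by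
    have h1 : |t * p i| ≤ t * (1 / 4) := by
      rw [abs_mul, abs_of_pos ht0]; exact mul_le_mul_of_nonneg_left (hp4 i) ht0.le
    rw [abs_le] at h1
    constructor <;> linarith [h1.1, h1.2]
  obtain ⟨R, hRc, hR0, hR2, φ, hφ⟩ := hbox (fun i ↦ t * p i) hu_mono hu_mem
  have hcrt : crossRatio (fun i ↦ t * p i) = x₀ := by
    have := crossRatio_affine p ht0.ne' 0
    simp only [add_zero] at this
    rw [this, hpx]
  have hboxlim : Tendsto (fun n : ℕ ↦ bondDomainCrossingProb R (t / n)) atTop (𝓝 (f x₀)) := by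
    have := hf R φ _ hφ
    rw [hcrt] at this
    exact BoxExhaustion.tendsto_comp_div_nat ht0 this
  have hR0' : R.arc 0 = {z : ℂ | z.im = 0 ∧ z.re ∈ Icc (t * m t 0) (t * m t 1)} := by
    rw [hR0, hm_mul t ht0 0, hm_mul t ht0 1]
  have hR2' : R.arc 2 = {z : ℂ | z.im = 0 ∧ z.re ∈ Icc (t * m t 2) (t * m t 3)} := by
    rw [hR2, hm_mul t ht0 2, hm_mul t ht0 3]
  /- Step 5: the two half-plane limits (C⁺). -/
  have hmt := hm_mono t ht0 ht1
  have hm01 := hmt (show (0 : Fin 4) < 1 by decide)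
  have hm12 := hmt (show (1 : Fin 4) < 2 by decide)
  have hm23 := hmt (show (2 : Fin 4) < 3 by decide)
  have hPlo : Tendsto (fun n : ℕ ↦ μ.real (openCrossing halfPlane (arcA (m t 0) (m t 1) n)
      (rowIcc ⌊m t 2 * n⌋ ⌊m t 3 * n⌋))) atTop
      (𝓝 (cardyFunction (crossRatio ![m t 0, m t 1, m t 2, m t 3]))) :=
    hC _ _ _ _ hm01 hm12 hm23
  have hPhi : Tendsto (fun n : ℕ ↦ μ.real (openCrossing halfPlane (arcA (m t 0 + ε') (m t 1) n)
      (rowIcc ⌊(m t 2 + ε') * n⌋ ⌊m t 3 * n⌋))) atTop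
      (𝓝 (cardyFunction (crossRatio ![m t 0 + ε', m t 1, m t 2 + ε', m t 3]))) :=
    hC _ _ _ _ (by linarith) (by linarith) (by linarith)
  /- Step 6: the lattice sandwich for all large `n`. -/
  set M₀ : ℕ := ⌈|m t 0 + ε'|⌉₊ + ⌈|m t 1|⌉₊ + 1 with hM₀
  have hM₀1 : 1 ≤ M₀ := by omega
  have hb0 : |m t 0| < 3 := by linarith [hbd 0]
  have hb1 : |m t 1| < 3 := by linarith [hbd 1]
  have hb2 : |m t 2| < 3 := by linarith [hbd 2]
  have hb3 : |m t 3| < 3 := by linarith [hbd 3]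
  have hb0' : |m t 0 + ε'| < 3 := by
    have := abs_add_le (m t 0) ε'; rw [abs_of_pos hε'0] at this; linarith [hbd 0]
  have hb2' : |m t 2 + ε'| < 3 := by
    have := abs_add_le (m t 2) ε'; rw [abs_of_pos hε'0] at this; linarith [hbd 2]
  have hM₀7 : (M₀ : ℝ) ≤ 7 := by
    have h1 : ⌈|m t 0 + ε'|⌉₊ ≤ 3 := Nat.ceil_le.2 (by push_cast; linarith)
    have h2 : ⌈|m t 1|⌉₊ ≤ 3 := Nat.ceil_le.2 (by push_cast; linarith)
    have : M₀ ≤ 7 := by omega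
    exact_mod_cast this
  -- the mark inequalities at mesh `t/n ≤ t`
  have htK4 : 4 * t ≤ K := by linarith
  have mk : ∀ x : ℝ, |x| < 3 → ∀ n : ℕ, 1 ≤ n → -K < t * x - t / n ∧ t * x + t / n < K :=
    fun x hx n hn ↦ mark_ineq ht0 htK4 hx hn
  have hev : ∀ᶠ n : ℕ in atTop,
      bondDomainCrossingProb R (t / n) ≤
          μ.real (openCrossing halfPlane (arcA (m t 0) (m t 1) n) (rowIcc ⌊m t 2 * n⌋ ⌊m t 3 * n⌋)) ∧
        μ.real (openCrossing halfPlane (arcA (m t 0 + ε') (m t 1) n)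
            (rowIcc ⌊(m t 2 + ε') * n⌋ ⌊m t 3 * n⌋)) ≤
          bondDomainCrossingProb R (t / n) + C₀ * ((L : ℝ)⁻¹) ^ α := by
    filter_upwards [eventually_ge_atTop (⌈1 / ε'⌉₊ + 1)] with n hn
    have hn1 : 1 ≤ n := by omega
    have hn0 : 0 < n := hn1
    have hnr : (1 : ℝ) ≤ n := by exact_mod_cast hn1
    have hnpos : (0 : ℝ) < n := by linarith
    have hδ : 0 < t / n := div_pos ht0 hnpos
    have hδt : t / n ≤ t := div_le_self ht0.le hnr
    have hεn : 1 ≤ ε' * n := by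
      have h1 : (⌈1 / ε'⌉₊ : ℝ) + 1 ≤ n := by exact_mod_cast hn
      have h2 : 1 / ε' ≤ ⌈1 / ε'⌉₊ := Nat.le_ceil _
      have h3 : 1 / ε' ≤ n := by linarith
      rwa [div_le_iff₀ hε'0, mul_comm] at h3
    have hH2 : 2 * (t / n) < H := by linarith
    constructor
    · exact BoxExhaustion.bondDomainCrossingProb_box_le hK ht0 hn0 hm01.le hm23.le hH2
        (mk _ hb0 n hn1).1 (mk _ hb1 n hn1).2 (mk _ hb2 n hn1).1 (mk _ hb3 n hn1).2 R hRc hR0' hR2'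
    · have haε : m t 0 * n + 1 ≤ (m t 0 + ε') * n := by rw [add_mul]; linarith
      have hcε : m t 2 * n + 1 ≤ (m t 2 + ε') * n := by rw [add_mul]; linarith
      have hr : ∀ k : ℤ, ⌊(m t 0 + ε') * n⌋ ≤ k → k ≤ ⌊m t 1 * n⌋ → |k| ≤ ((M₀ * n : ℕ) : ℤ) := by
        intro k h1 h2
        have := BoxExhaustion.abs_le_of_floor_bounds hn1 h1 h2
        rw [hM₀]; push_cast at this ⊢; linarith
      have hrR : M₀ * n ≤ M₀ * n * L := Nat.le_mul_of_pos_right _ (by omega)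
      have hgeo : t / n * ((M₀ * n * L : ℕ) + 1) < min K H := by
        have e : t / n * ((M₀ * n * L : ℕ) + 1) = t * L * M₀ + t / n := by
          push_cast
          field_simp
        rw [e, htL]
        have h7 : κ * M₀ ≤ κ * 7 := mul_le_mul_of_nonneg_left hM₀7 hκ0.le
        have : t / n ≤ κ := hδt.trans htκ
        linarith
      have hup := BoxExhaustion.measureReal_openCrossing_halfPlane_le hK ht0 hn0 haε hcε hH2.le
        (by linarith [(mk _ hb0 n hn1).1]) (mk _ hb1 n hn1).2.le (by linarith [(mk _ hb2 n hn1).1])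
        (mk _ hb3 n hn1).2.le hr hrR hgeo R hRc hR0' hR2'
      have hescL := BoxExhaustion.escape_le hesc hM₀1 hn1 hL
      linarith
  /- Step 7: pass to the limit `n → ∞` and combine. -/
  have hlow : f x₀ ≤ cardyFunction (crossRatio ![m t 0, m t 1, m t 2, m t 3]) :=
    le_of_tendsto_of_tendsto hboxlim hPlo (hev.mono fun n hn ↦ hn.1)
  have hhigh : cardyFunction (crossRatio ![m t 0 + ε', m t 1, m t 2 + ε', m t 3]) ≤
      f x₀ + C₀ * ((L : ℝ)⁻¹) ^ α :=
    le_of_tendsto_of_tendsto hPhi (hboxlim.add_const _) (hev.mono fun n hn ↦ hn.2)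
  rw [abs_le]
  constructor <;> linarith

end Rigidity

/-- **C⁺ pins the limit**: under the collinear half-plane Cardy law for bond-`ℤ²`, a function that is a
crossing limit of every conformal rectangle equals Cardy's `F` on `(0,1)`. [folklore] -/
theorem eqOn_cardyFunction_of_collinearCardy
    (hC : ∀ a b c y : ℝ, a < b → b < c → c < y →
      Tendsto (fun n : ℕ ↦ μ.real (openCrossing halfPlane (arcA a b n) (rowIcc ⌊c * n⌋ ⌊y * n⌋))) atTop
        (𝓝 (Literature.Probability.RandomPlanarGeometry.cardyFunction
          (Literature.Probability.RandomPlanarGeometry.crossRatio ![a, b, c, y]))))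
    (f : ℝ → ℝ) (hf : ∀ R : ConformalRectangle, R.HasCrossingLimit (bondDomainCrossingProb R) f) :
    EqOn f Literature.Probability.RandomPlanarGeometry.cardyFunction (Ioo 0 1) :=
  Rigidity.eqOn_cardyFunction_of_collinearCardy hC f hf

/-- **Crux 5 pins the limit**: `HalfPlaneMarkDensityLaw` identifies every conformal crossing limit of
bond-`ℤ²` with Cardy's `F` on `(0,1)` (registered stub, verbatim signature). [folklore] -/
theorem eqOn_cardyFunction_of_halfPlaneMarkDensityLaw :
    Summit.CriticalPhenomena.CardyFormulaZ2.Theses.CardyBoundaryCoulombGas.HalfPlaneMarkDensityLaw →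
      ∀ f : ℝ → ℝ, (∀ R : Literature.Probability.RandomPlanarGeometry.ConformalRectangle,
        R.HasCrossingLimit (Literature.Probability.Percolation.bondDomainCrossingProb R) f) →
          Set.EqOn f Literature.Probability.RandomPlanarGeometry.cardyFunction (Set.Ioo 0 1) :=
  fun h f hf ↦ eqOn_cardyFunction_of_collinearCardy (stub_converse h) f hf

/-- **C⁺ discharges the conclusion of `HalfStripRigidity`** (stmt-CriticalPhenomena-5181, route
CardyPerronTeleport): given C⁺, every universal conformal crossing limit `f` is `F` on `(0,1)`
(registered stub, verbatim signature). [folklore] -/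
theorem halfStripRigidity_of_collinearCardy :
    (∀ a b c y : ℝ, a < b → b < c → c < y →
      Tendsto (fun n : ℕ ↦ μ.real (openCrossing halfPlane (arcA a b n) (rowIcc ⌊c * n⌋ ⌊y * n⌋))) atTop
        (𝓝 (Literature.Probability.RandomPlanarGeometry.cardyFunction
          (Literature.Probability.RandomPlanarGeometry.crossRatio ![a, b, c, y])))) →
      ∀ f : ℝ → ℝ, (∀ R : Literature.Probability.RandomPlanarGeometry.ConformalRectangle,
        R.HasCrossingLimit (Literature.Probability.Percolation.bondDomainCrossingProb R) f) →
          Set.EqOn f Literature.Probability.RandomPlanarGeometry.cardyFunction (Set.Ioo 0 1) :=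
  fun hC ↦ eqOn_cardyFunction_of_collinearCardy hC

end Summit.CriticalPhenomena.CardyFormulaZ2.Cruxes.HalfPlaneMarkDensityLaw.SketchLine

end
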